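import Summits.BirchSwinnertonDyer.BirchSwinnertonDyer.Theses.TameQuarticManinParity
import Summits.BirchSwinnertonDyer.BirchSwinnertonDyer.Theorems.TameQuarticManinParityTwistPairAtThree
import Summits.BirchSwinnertonDyer.BirchSwinnertonDyer.Theorems.TameQuarticManinParityDegreeSplitGlue
import HarnessLib

/-!
# Route `TameQuarticManinParity`, LINE 40 (bsd-idea-3 g11), glue G40 `TprimeRedThreeDvdDegreeOfTameStarred`
# (stmt-BirchSwinnertonDyer-24058) — PROVED BY NAME (the planner's `Sketch40.lean` / `Sketch40b.lean`, re-checked by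
# refuter ref-g8 b16)

Cell `pub/bsd-wall`, D-0145 line `route-BirchSwinnertonDyer-TeichmullerTwistDescent`, seat `bsd-line-ttd-p1` g15,
working the planner-of-record's TQMP LINE 40. BSD is NOT proved by this; Manin's conjecture is not proved by this;
E57′ (`TprimeTameStarredOptimalManinUnit`, stmt-24046) and K19 (`TprimeRedKodairaThreeManinUnitOfThreeDvdDegree`,
stmt-27753) stay OPEN, hence so does the reducible hard half `TprimeRedManinUnitOfThreeDvdDegree` (stmt-24627).
This file closes ONLY the glue, and records the by-name corollary towards `TprimeReducibleManinUnit` (23737).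

## Statement (verbatim the route decl)

`TprimeTameStarredOptimalManinUnit → TprimeRedKodairaThreeManinUnitOfThreeDvdDegree → TprimeRedManinUnitOfThreeDvdDegree`.

## Proof

Split the (t′) rows by `ord₃ Δ_min ∈ {3, 9}` (`TwistPairAtThree.padicValInt_eq_three_or_nine_of_subTprime`,
landed): K19 serves the Kodaira-III rows on the same binders, E57′ the III* rows (it ignores ¬CM, reducibility and
3 ∣ deg φ). Pure logic. Design: theorems only; no definition, no named fact, no `sorry`; axioms `propext`,
`Classical.choice`, `Quot.sound`.
-/

set_option autoImplicit false
-- D-0017: single-problem summit, so `Summit.BirchSwinnertonDyer.BirchSwinnertonDyer.…` repeats a namespace BY DESIGN.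
set_option linter.dupNamespace false

namespace Summit.BirchSwinnertonDyer.BirchSwinnertonDyer.Theorems.TameQuarticManinParity

open Summit.BirchSwinnertonDyer.BirchSwinnertonDyer.Theses.TameQuarticManinParity

/-- **Glue G40** (stmt-BirchSwinnertonDyer-24058), by name: the III*-cell optimal Manin unit E57′ and the
Kodaira-III half K19 give the reducible hard half `TprimeRedManinUnitOfThreeDvdDegree`, by the landed split
`ord₃ Δ_min ∈ {3, 9}` on the (t′) cell (`TwistPairAtThree.padicValInt_eq_three_or_nine_of_subTprime`). -/
theorem tprimeRedThreeDvdDegreeOfTameStarred_proof : TprimeRedThreeDvdDegreeOfTameStarred := by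
  unfold TprimeRedThreeDvdDegreeOfTameStarred TprimeRedManinUnitOfThreeDvdDegree
  intro h57 hK19 W _ _ _ hCM hadd ht hred D hL hopt h3deg
  rcases TwistPairAtThree.padicValInt_eq_three_or_nine_of_subTprime W hadd ht with h3 | h9
  · exact hK19 W hCM hadd ht hred D hL hopt h3 h3deg
  · exact h57 W hadd ht h9 D hL hopt

/-- Corollary by name (LINE 40 cone consequence): with G40, the whole reducible organ `TprimeReducibleManinUnit`
(stmt-23737) follows from E57′ ∧ K19 ∧ the ČNS half `TprimeRedManinUnitOfDegreePrimeToThree` (24628) through the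
landed degree-split glue `tprimeRedOfDegreeSplit_proof` (24629). -/
theorem tprimeReducibleManinUnit_of_tameStarred_of_kodairaThree_of_cns
    (h57 : TprimeTameStarredOptimalManinUnit) (hK19 : TprimeRedKodairaThreeManinUnitOfThreeDvdDegree)
    (hCNS : TprimeRedManinUnitOfDegreePrimeToThree) : TprimeReducibleManinUnit :=
  tprimeRedOfDegreeSplit_proof (tprimeRedThreeDvdDegreeOfTameStarred_proof h57 hK19) hCNS

end Summit.BirchSwinnertonDyer.BirchSwinnertonDyer.Theorems.TameQuarticManinParity
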